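import Mathlib
import HarnessLib
import Summits.MatrixMultiplication.MatrixMultiplication.Theorems.OutsiderSandwichToricCeilingPowSubTwoRules

/-!
# OutsiderSandwich — toric ceilings in MIXED product bases of `cw₂^{⊠N}`, part 1: perfect
matchings in a general product frame and the slicing glue at a permutation pivot
(decomp-mm lens 4, gen 46, kernel K46-2a; THESES-FREE, `ω`-free; helper toward `LaserTangency`,
stmt-32268 — the extremal subrank/packing cells of the literal host `kroneckerPow (cwTensor ℂ 2) N`)

LABEL.  TORIC · uniform in `N` · NEC-side instrument of the decomposition cell; the rates / the crux
`h₁ = LaserTangency` and the route's `closes` are untouched.  Infrastructure only: this part decides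
no statement about `cw₂^{⊠N}`; it is used by part 2 (`…PowMixedStar`, the STAR LEMMA) and by the
co-size-2 slices of the mixed-basis analogue of K45 (`…ToricCeilingPowSubTwo`, all coordinates in
the permutation basis), see NODE-g46 (decomp-mm lens 4).

SETTING.  A product basis of `cw₂^{⊠N}` is a flag word `κ : Fin N → Bool` (`true` = the
Coppersmith–Winograd basis `{x₀yᵢzᵢ + xᵢy₀zᵢ + xᵢyᵢz₀}`, `false` = the permutation basis
`D = x₀x₁x₂`), and its support is the product frame `frame κ` of `…ToricCeilingPowFibres`.  K45
treats `κ ≡ false`; its matchings of full layers and of star complements are translation classes,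
which do not exist as soon as one coordinate is in the cw basis (a cw slot `(0,i,i), (i,0,i),
(i,i,0)` contains the letter `1` an even number of times, so the full frame and the complement of a
frame triple have NO perfect matching when some `κ i = true`: `3^N` is odd).  What survives is the
SLICING at a coordinate `p` in the permutation basis, which is all the induction needs when at most
one coordinate is in the cw basis.

WHAT.
* §1–§2: `isPMκ κ P X Y Z` — `P ⊆ frame κ` is a leg-injective perfect matching of the complement of
  the word sets `X, Y, Z` (for `κ ≡ false` this is K45's `isPM`, `isPMκ_tight`, by `rfl`);
  `isPMκ_iff`, `isPMκ_rot` (every product frame is invariant under rotating the legs).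
* §3: slicing at a PERMUTATION pivot `p` (`κ p = false`): the tail flag word `tailκ`,
  `mk3_mem_frame`, `lift3_mem_frame`, and `isPMκ_glue` — K45's `isPM_glue` verbatim over
  `frame κ`, the tail instances living in the tail frame `frame (tailκ p κ)`.
All definitions are plain data (`Bool` / `Finset`); no new axioms.
-/

set_option linter.dupNamespace false

namespace Summit.MatrixMultiplication.MatrixMultiplication.Theorems.OutsiderSandwichToricCeilingPowMixedGlue

open Finset
open Summit.MatrixMultiplication.MatrixMultiplication.Theorems.OutsiderSandwichToricCeiling
  (cwSlot dSlot)
open Summit.MatrixMultiplication.MatrixMultiplication.Theorems.OutsiderSandwichToricCeilingPowFibres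
  (Word Tr3 slotB frame)
open Summit.MatrixMultiplication.MatrixMultiplication.Theorems.OutsiderSandwichToricCeilingPowSubTwoGlue
open Summit.MatrixMultiplication.MatrixMultiplication.Theorems.OutsiderSandwichToricCeilingPowSubTwoRules

variable {m : ℕ}

/-! ## §1 Slot letters and membership in a product frame -/

/-- The permutation slot: three pairwise distinct letters. -/
theorem slotB_false_iff {x y z : Fin 3} : slotB false x y z = true ↔ x ≠ y ∧ y ≠ z ∧ x ≠ z := by
  simp [slotB, dSlot]

/-- Both slot patterns are invariant under the cyclic rotation of the legs. -/
theorem slotB_rot : ∀ (b : Bool) (x y z : Fin 3), slotB b y z x = slotB b x y z := by decide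

/-- Membership in the product frame of the flag word `κ`: coordinatewise slot condition. -/
theorem mem_frame {κ : Fin m → Bool} {t : Tr3 m} :
    t ∈ frame κ ↔ ∀ i, slotB (κ i) (t.1 i) (t.2.1 i) (t.2.2 i) = true := by
  simp [frame]

/-! ## §2 Perfect matchings of a complement in a product frame -/

/-- `P` is a PERFECT MATCHING of the product frame `frame κ` with the vertex sets `X, Y, Z` removed:
a leg-injective set of frame triples whose leg images are exactly the complements of `X`, `Y`, `Z`
(Boolean form; unfolded by `isPMκ_iff`). [new] -/
def isPMκ (κ : Fin m → Bool) (P : Finset (Tr3 m)) (X Y Z : Finset (Word m)) : Bool :=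
  decide (P ⊆ frame κ ∧
    #(P.image fun t => t.1) = #P ∧ #(P.image fun t => t.2.1) = #P ∧ #(P.image fun t => t.2.2) = #P ∧
    P.image (fun t => t.1) = univ \ X ∧ P.image (fun t => t.2.1) = univ \ Y ∧
    P.image (fun t => t.2.2) = univ \ Z)

/-- In the all-permutation basis `isPMκ` is K45's `isPM` (definitionally). -/
theorem isPMκ_tight (P : Finset (Tr3 m)) (X Y Z : Finset (Word m)) :
    isPMκ (fun _ : Fin m => false) P X Y Z = isPM P X Y Z := rfl

/-- `isPMκ` unfolded: sub-frame, leg-injective, the three leg images are the complements. -/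
theorem isPMκ_iff {κ : Fin m → Bool} {P : Finset (Tr3 m)} {X Y Z : Finset (Word m)} :
    isPMκ κ P X Y Z = true ↔
    P ⊆ frame κ ∧
    Set.InjOn (fun t : Tr3 m => t.1) P ∧ Set.InjOn (fun t : Tr3 m => t.2.1) P ∧
    Set.InjOn (fun t : Tr3 m => t.2.2) P ∧
    P.image (fun t => t.1) = univ \ X ∧ P.image (fun t => t.2.1) = univ \ Y ∧
    P.image (fun t => t.2.2) = univ \ Z := by
  rw [isPMκ, decide_eq_true_iff, card_image_iff, card_image_iff, card_image_iff]

/-- Rotating the legs `(A, B, C) ↦ (B, C, A)` of a perfect matching of the complement of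
`(X, Y, Z)` gives one of the complement of `(Y, Z, X)` (every product frame is rotation
invariant). -/
theorem isPMκ_rot {κ : Fin m → Bool} {P : Finset (Tr3 m)} {X Y Z : Finset (Word m)}
    (h : isPMκ κ P X Y Z = true) : isPMκ κ (P.image rot) Y Z X = true := by
  obtain ⟨hsub, j₁, j₂, j₃, i₁, i₂, i₃⟩ := isPMκ_iff.1 h
  rw [isPMκ_iff]
  refine ⟨?_, ?_, ?_, ?_, ?_, ?_, ?_⟩
  · intro s hs
    rw [mem_image] at hs
    obtain ⟨t, ht, rfl⟩ := hs
    have hf := mem_frame.1 (hsub ht)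
    rw [mem_frame]
    intro i
    rw [← hf i]
    exact slotB_rot _ _ _ _
  · intro s hs s' hs' e
    simp only [coe_image, Set.mem_image, mem_coe] at hs hs'
    obtain ⟨t, ht, rfl⟩ := hs
    obtain ⟨t', ht', rfl⟩ := hs'
    rw [j₂ ht ht' e]
  · intro s hs s' hs' e
    simp only [coe_image, Set.mem_image, mem_coe] at hs hs'
    obtain ⟨t, ht, rfl⟩ := hs
    obtain ⟨t', ht', rfl⟩ := hs'
    rw [j₃ ht ht' e]
  · intro s hs s' hs' e
    simp only [coe_image, Set.mem_image, mem_coe] at hs hs'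
    obtain ⟨t, ht, rfl⟩ := hs
    obtain ⟨t', ht', rfl⟩ := hs'
    rw [j₁ ht ht' e]
  · rw [image_image]; exact i₂
  · rw [image_image]; exact i₃
  · rw [image_image]; exact i₁

/-! ## §3 Slicing at a permutation pivot -/

/-- The flag word of the TAILS at the pivot `p`. [new] -/
def tailκ (p : Fin (m + 1)) (κ : Fin (m + 1) → Bool) : Fin m → Bool := fun j => κ (p.succAbove j)

/-- The tail flag at `j` is the flag at `p.succAbove j`. -/
@[simp] theorem tailκ_apply (p : Fin (m + 1)) (κ : Fin (m + 1) → Bool) (j : Fin m) :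
    tailκ p κ j = κ (p.succAbove j) := rfl

/-- At most one cw coordinate is inherited by the tails. -/
theorem tailκ_atMostOne {p : Fin (m + 1)} {κ : Fin (m + 1) → Bool}
    (hκ : ∀ i j, κ i = true → κ j = true → i = j) :
    ∀ i j, tailκ p κ i = true → tailκ p κ j = true → i = j :=
  fun _ _ hi hj => Fin.succAbove_right_injective (hκ _ _ hi hj)

/-- Three words with prescribed letters at a PERMUTATION pivot lie in the frame iff the pivot
letters are distinct and the tails lie in the tail frame. -/
theorem mk3_mem_frame {p : Fin (m + 1)} {κ : Fin (m + 1) → Bool} (hp : κ p = false)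
    {a b c : Fin 3} {u v w : Word m} :
    ((ins p a u, ins p b v, ins p c w) : Tr3 (m + 1)) ∈ frame κ ↔
      (a ≠ b ∧ b ≠ c ∧ a ≠ c) ∧ ((u, v, w) : Tr3 m) ∈ frame (tailκ p κ) := by
  rw [mem_frame, mem_frame, Fin.forall_iff_succAbove p, hp]
  simp [slotB_false_iff]

/-- A lifted triple lies in the frame iff the slot letters are distinct and the tail triple lies in
the tail frame (permutation pivot). -/
theorem lift3_mem_frame {p : Fin (m + 1)} {κ : Fin (m + 1) → Bool} (hp : κ p = false)
    {a b c : Fin 3} {s : Tr3 m} :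
    lift3 p a b c s ∈ frame κ ↔ (a ≠ b ∧ b ≠ c ∧ a ≠ c) ∧ s ∈ frame (tailκ p κ) := by
  rw [lift3, mk3_mem_frame hp]

/-- **The glue is a perfect matching** (K45 `isPM_glue` over a general product frame, the pivot in
the permutation basis): auxiliary triples in the frame, leg-injective, avoiding `X, Y, Z`, and for
every pivot letter `a` a perfect matching `Q a` of the slot's layers minus `X, Y, Z` and minus the
auxiliary vertices, inside the TAIL frame. -/
theorem isPMκ_glue {p : Fin (m + 1)} {κ : Fin (m + 1) → Bool} (hp : κ p = false) {d : Fin 3}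
    (hd : d ≠ 0) {Aux : Finset (Tr3 (m + 1))} {Q : Fin 3 → Finset (Tr3 m)}
    {X Y Z : Finset (Word (m + 1))} (hAf : Aux ⊆ frame κ)
    (jA₁ : Set.InjOn (fun t : Tr3 (m + 1) => t.1) Aux)
    (jA₂ : Set.InjOn (fun t : Tr3 (m + 1) => t.2.1) Aux)
    (jA₃ : Set.InjOn (fun t : Tr3 (m + 1) => t.2.2) Aux)
    (hAX : ∀ t ∈ Aux, t.1 ∉ X) (hAY : ∀ t ∈ Aux, t.2.1 ∉ Y) (hAZ : ∀ t ∈ Aux, t.2.2 ∉ Z)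
    (hQ : ∀ a, isPMκ (tailκ p κ) (Q a) (layer p a (X ∪ Aux.image fun t => t.1))
      (layer p (a + d) (Y ∪ Aux.image fun t => t.2.1))
      (layer p (a + d + d) (Z ∪ Aux.image fun t => t.2.2)) = true) :
    isPMκ κ (glue p d Aux Q) X Y Z = true := by
  replace hQ := fun a => isPMκ_iff.1 (hQ a)
  rw [isPMκ_iff]
  obtain ⟨l₁, i₁⟩ := glue_leg (πM := fun t : Tr3 (m + 1) => t.1) (πm := fun t : Tr3 m => t.1)
    (e := fun a => a) (fun a b h => h) (fun a s => rfl) X jA₁ hAX (fun a => (hQ a).2.1)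
    (fun a => (hQ a).2.2.2.2.1)
  obtain ⟨l₂, i₂⟩ := glue_leg (πM := fun t : Tr3 (m + 1) => t.2.1) (πm := fun t : Tr3 m => t.2.1)
    (e := fun a => a + d) (add_left_injective d) (fun a s => rfl) Y jA₂ hAY
    (fun a => (hQ a).2.2.1) (fun a => (hQ a).2.2.2.2.2.1)
  obtain ⟨l₃, i₃⟩ := glue_leg (πM := fun t : Tr3 (m + 1) => t.2.2) (πm := fun t : Tr3 m => t.2.2)
    (e := fun a => a + d + d) (fun a b h => add_left_injective d (add_left_injective d h))
    (fun a s => rfl) Z jA₃ hAZ (fun a => (hQ a).2.2.2.1) (fun a => (hQ a).2.2.2.2.2.2)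
  refine ⟨?_, l₁, l₂, l₃, i₁, i₂, i₃⟩
  intro t ht
  rw [mem_glue] at ht
  rcases ht with ht | ⟨a, s, hs, rfl⟩
  · exact hAf ht
  · exact (lift3_mem_frame hp).2 ⟨F3.lift_ne a d hd, (hQ a).1 hs⟩

end Summit.MatrixMultiplication.MatrixMultiplication.Theorems.OutsiderSandwichToricCeilingPowMixedGlue
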